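import Summits.Ventures.DiscreteObjects.MOLS.PlaneOfMOLS
import Summits.Ventures.DiscreteObjects.Verify.DesignsKernel

/-!
# Soundness of verify-ref's Bool checker `isProjectivePlane`: a certified line list IS a projective plane of order `n` (kernel glue)
Framing: lottery ticket; floor = certified bounds/negative ranges.

Cell pub-namedobj (venture DiscreteObjects), target (M), designs gen 9.  verify-ref's `Verify.isProjectivePlane n lines`
(`DesignsKernel`) checks a list of `n² + n + 1` lines on the points `0 … n² + n`: every line has `n + 1` distinct points, two
points lie on exactly one listed line, two listed lines meet in exactly one point.  This file proves the checker SOUND against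
Mathlib's `Configuration.ProjectivePlane`: from `isProjectivePlane n lines = true` and `2 ≤ n` it CONSTRUCTS a projective plane
(`certPlane`) on the index types `CPt`, `CLn` and proves `order = n` (`order_certPlane`), whence
**`existsPlane_of_certificate`** — `∃` a finite projective plane of order `n` — and, for the census target (M-b),
**`existsPlaneOrder12_of_certificate : isProjectivePlane 12 lines = true → ExistsProjectivePlaneOrder12`** (a PP(12) HIT given as
157 lines of 13 points is ONE Bool evaluation plus this theorem).  Control: `exists_plane_order_two_of_fano` from verify-ref's
`fano_ok`.  Glue only (the axioms of a projective plane, read off a Bool certificate); no new mathematics; no `sorry`.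
-/

namespace Summit.Ventures.DiscreteObjects.PP12

open Configuration List Summit.Ventures.DiscreteObjects.Verify Summit.Ventures.DiscreteObjects.MOLS

/-! ### Unpacking the checker -/

section Unpack

variable {n : ℕ} {lines : List (List ℕ)}

/-- the four clauses of `isProjectivePlane` -/
theorem isProjectivePlane_iff' : isProjectivePlane n lines = true ↔
    lines.length = n * n + n + 1 ∧
    (∀ l ∈ lines, l.length = n + 1 ∧ l.Nodup ∧ ∀ x ∈ l, x < n * n + n + 1) ∧
    (∀ p < n * n + n + 1, ∀ q < n * n + n + 1, p < q →
      (lines.filter fun l => l.contains p && l.contains q).length = 1) ∧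
    (∀ a < n * n + n + 1, ∀ b < n * n + n + 1, a < b →
      ((lines.getD a []).filter fun p => (lines.getD b []).contains p).length = 1) := by
  simp only [isProjectivePlane, Bool.and_eq_true, all_eq_true, decide_eq_true_eq, mem_range, Bool.or_eq_true, Bool.and_assoc]
  constructor
  · rintro ⟨h1, h2, h3, h4⟩
    refine ⟨h1, fun l hl => ?_, fun p hp q hq hpq => ?_, fun a ha b hb hab => ?_⟩
    · obtain ⟨e1, e2, e3⟩ := h2 l hl
      exact ⟨e1, e2, e3⟩
    · rcases h3 p hp q hq with h | h
      · omega
      · exact h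
    · rcases h4 a ha b hb with h | h
      · omega
      · exact h
  · rintro ⟨h1, h2, h3, h4⟩
    refine ⟨h1, fun l hl => ?_, fun p hp q hq => ?_, fun a ha b hb => ?_⟩
    · obtain ⟨e1, e2, e3⟩ := h2 l hl
      exact ⟨e1, e2, e3⟩
    · by_cases hpq : p < q
      · exact Or.inr (h3 p hp q hq hpq)
      · exact Or.inl (by omega)
    · by_cases hab : a < b
      · exact Or.inr (h4 a ha b hb hab)
      · exact Or.inl (by omega)

/-- two distinct indices whose entries satisfy a predicate force at least two elements in the filter -/
theorem two_le_length_filter {α : Type*} (l : List α) (P : α → Bool) {a b : ℕ} (ha : a < l.length) (hb : b < l.length)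
    (hab : a < b) (hPa : P (l[a]) = true) (hPb : P (l[b]) = true) : 2 ≤ (l.filter P).length := by
  have hsub : [l[a], l[b]] <+ l := by
    have := map_getElem_sublist (l := l) (is := [⟨a, ha⟩, ⟨b, hb⟩]) (by simp [hab])
    simpa using this
  have := (hsub.filter P).length_le
  simp [List.filter, hPa, hPb] at this
  exact this

end Unpack

/-! ### The certified structure -/

/-- points of the certified structure: indices `0 … n² + n` -/
structure CPt (n : ℕ) (lines : List (List ℕ)) where
  /-- the index -/
  idx : Fin (n * n + n + 1)
deriving DecidableEq

/-- lines of the certified structure: positions in the line list -/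
structure CLn (n : ℕ) (lines : List (List ℕ)) where
  /-- the position -/
  idx : Fin (n * n + n + 1)
deriving DecidableEq

namespace CPt

variable {n : ℕ} {lines : List (List ℕ)}

/-- points with the same index are equal -/
@[ext] theorem ext {p q : CPt n lines} (h : p.idx = q.idx) : p = q := by
  cases p; cases q; congr

/-- `CPt ≃ Fin (n² + n + 1)` -/
def equivFin : CPt n lines ≃ Fin (n * n + n + 1) where
  toFun := fun p => p.idx
  invFun := fun i => ⟨i⟩
  left_inv := fun _ => rfl
  right_inv := fun _ => rfl

/-- finitely many points -/
instance : Fintype (CPt n lines) := Fintype.ofEquiv _ equivFin.symm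

/-- `n² + n + 1` points -/
theorem card : Fintype.card (CPt n lines) = n * n + n + 1 := by
  rw [Fintype.ofEquiv_card, Fintype.card_fin]

end CPt

namespace CLn

variable {n : ℕ} {lines : List (List ℕ)}

/-- lines with the same position are equal -/
@[ext] theorem ext {l m : CLn n lines} (h : l.idx = m.idx) : l = m := by
  cases l; cases m; congr

/-- `CLn ≃ Fin (n² + n + 1)` -/
def equivFin : CLn n lines ≃ Fin (n * n + n + 1) where
  toFun := fun l => l.idx
  invFun := fun i => ⟨i⟩
  left_inv := fun _ => rfl
  right_inv := fun _ => rfl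

/-- finitely many lines -/
instance : Fintype (CLn n lines) := Fintype.ofEquiv _ equivFin.symm

end CLn

variable {n : ℕ} {lines : List (List ℕ)}

/-- the point set of the line at position `l` -/
def pts (lines : List (List ℕ)) (l : ℕ) : List ℕ := lines.getD l []

/-- incidence: the point's index is listed on the line -/
instance : Membership (CPt n lines) (CLn n lines) := ⟨fun l p => (p.idx : ℕ) ∈ pts lines l.idx⟩

/-- incidence, unfolded -/
theorem mem_iff {p : CPt n lines} {l : CLn n lines} : p ∈ l ↔ (p.idx : ℕ) ∈ pts lines l.idx := Iff.rfl

section Axioms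

variable (h : isProjectivePlane n lines = true)
include h

/-- the certificate lists `n² + n + 1` lines -/
theorem length_lines : lines.length = n * n + n + 1 := (isProjectivePlane_iff'.mp h).1

/-- the point set at a valid position is the listed line -/
theorem pts_eq_getElem {a : ℕ} (ha : a < n * n + n + 1) :
    pts lines a = lines[a]'(by rw [length_lines h]; exact ha) := by
  simp only [pts, getD_eq_getElem lines [] (by rw [length_lines h]; exact ha)]

/-- the point set at a valid position is one of the listed lines -/
theorem pts_mem {a : ℕ} (ha : a < n * n + n + 1) : pts lines a ∈ lines := by
  rw [pts_eq_getElem h ha]; exact getElem_mem _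

/-- every line has `n + 1` points -/
theorem length_pts {a : ℕ} (ha : a < n * n + n + 1) : (pts lines a).length = n + 1 :=
  ((isProjectivePlane_iff'.mp h).2.1 _ (pts_mem h ha)).1

/-- the points of a line are distinct -/
theorem nodup_pts {a : ℕ} (ha : a < n * n + n + 1) : (pts lines a).Nodup :=
  ((isProjectivePlane_iff'.mp h).2.1 _ (pts_mem h ha)).2.1

/-- the points of a line are valid indices -/
theorem lt_of_mem_pts {a : ℕ} (ha : a < n * n + n + 1) {x : ℕ} (hx : x ∈ pts lines a) : x < n * n + n + 1 :=
  ((isProjectivePlane_iff'.mp h).2.1 _ (pts_mem h ha)).2.2 x hx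

/-- **two points lie on a listed line** -/
theorem exists_line_through {p q : ℕ} (hp : p < n * n + n + 1) (hq : q < n * n + n + 1) (hpq : p ≠ q) :
    ∃ a < n * n + n + 1, p ∈ pts lines a ∧ q ∈ pts lines a := by
  -- w.l.o.g. `p < q` — the filter predicate is symmetric up to `Bool.and_comm`
  have key : ∀ {p q : ℕ}, p < n * n + n + 1 → q < n * n + n + 1 → p < q →
      ∃ a < n * n + n + 1, p ∈ pts lines a ∧ q ∈ pts lines a := by
    intro p q hp hq hpq
    have h1 := (isProjectivePlane_iff'.mp h).2.2.1 p hp q hq hpq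
    obtain ⟨l₀, hl₀⟩ := length_eq_one_iff.mp h1
    have hmem : l₀ ∈ lines.filter fun l => l.contains p && l.contains q := by rw [hl₀]; exact mem_singleton_self _
    rw [mem_filter] at hmem
    obtain ⟨hl, hP⟩ := hmem
    simp only [Bool.and_eq_true, contains_iff_mem] at hP
    obtain ⟨a, ha, rfl⟩ := mem_iff_getElem.mp hl
    rw [length_lines h] at ha
    exact ⟨a, ha, by rw [pts_eq_getElem h ha]; exact hP⟩
  rcases Nat.lt_or_gt_of_ne hpq with hlt | hgt
  · exact key hp hq hlt
  · obtain ⟨a, ha, h1, h2⟩ := key hq hp hgt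
    exact ⟨a, ha, h2, h1⟩

/-- **… on only one** (as positions in the list) -/
theorem line_through_unique {p q : ℕ} (hp : p < n * n + n + 1) (hq : q < n * n + n + 1) (hpq : p ≠ q) {a b : ℕ}
    (ha : a < n * n + n + 1) (hb : b < n * n + n + 1) (hpa : p ∈ pts lines a) (hqa : q ∈ pts lines a)
    (hpb : p ∈ pts lines b) (hqb : q ∈ pts lines b) : a = b := by
  have key : ∀ {p q : ℕ}, p < n * n + n + 1 → q < n * n + n + 1 → p < q → ∀ {a b : ℕ}, a < n * n + n + 1 →
      b < n * n + n + 1 → a < b → p ∈ pts lines a → q ∈ pts lines a → p ∈ pts lines b → q ∈ pts lines b → False := by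
    intro p q hp hq hpq a b ha hb hab hpa hqa hpb hqb
    have h1 := (isProjectivePlane_iff'.mp h).2.2.1 p hp q hq hpq
    have ha' : a < lines.length := by rw [length_lines h]; exact ha
    have hb' : b < lines.length := by rw [length_lines h]; exact hb
    have h2 := two_le_length_filter lines (fun l => l.contains p && l.contains q) ha' hb' hab
      (by rw [← pts_eq_getElem h ha]; simp [hpa, hqa])
      (by rw [← pts_eq_getElem h hb]; simp [hpb, hqb])
    omega
  by_contra hab
  rcases Nat.lt_or_gt_of_ne hpq with hlt | hgt
  · rcases Nat.lt_or_gt_of_ne hab with h' | h'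
    · exact key hp hq hlt ha hb h' hpa hqa hpb hqb
    · exact key hp hq hlt hb ha h' hpb hqb hpa hqa
  · rcases Nat.lt_or_gt_of_ne hab with h' | h'
    · exact key hq hp hgt ha hb h' hqa hpa hqb hpb
    · exact key hq hp hgt hb ha h' hqb hpb hqa hpa

/-- **two listed lines meet** -/
theorem exists_meet {a b : ℕ} (ha : a < n * n + n + 1) (hb : b < n * n + n + 1) (hab : a ≠ b) :
    ∃ p, p ∈ pts lines a ∧ p ∈ pts lines b := by
  have key : ∀ {a b : ℕ}, a < n * n + n + 1 → b < n * n + n + 1 → a < b → ∃ p, p ∈ pts lines a ∧ p ∈ pts lines b := by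
    intro a b ha hb hab
    have h1 := (isProjectivePlane_iff'.mp h).2.2.2 a ha b hb hab
    obtain ⟨p₀, hp₀⟩ := length_eq_one_iff.mp h1
    have hmem : p₀ ∈ (lines.getD a []).filter fun p => (lines.getD b []).contains p := by
      rw [hp₀]; exact mem_singleton_self _
    rw [mem_filter, contains_iff_mem] at hmem
    exact ⟨p₀, hmem.1, hmem.2⟩
  rcases Nat.lt_or_gt_of_ne hab with hlt | hgt
  · exact key ha hb hlt
  · obtain ⟨p, h1, h2⟩ := key hb ha hgt
    exact ⟨p, h2, h1⟩

/-- a line misses some point (`n + 1 < n² + n + 1` for `1 ≤ n`) -/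
theorem exists_not_mem_pts (hn : 1 ≤ n) {a : ℕ} (ha : a < n * n + n + 1) : ∃ p < n * n + n + 1, p ∉ pts lines a := by
  by_contra hall
  simp only [not_exists, not_and, not_not] at hall
  have hsub : range (n * n + n + 1) ⊆ pts lines a := fun p hp => hall p (mem_range.mp hp)
  have := ((subperm_of_subset nodup_range hsub).length_le)
  rw [length_range, length_pts h ha] at this
  nlinarith

/-- three distinct points on a line (`2 ≤ n`) -/
theorem exists_three_mem_pts (hn : 2 ≤ n) {a : ℕ} (ha : a < n * n + n + 1) :
    ∃ x y z, x ∈ pts lines a ∧ y ∈ pts lines a ∧ z ∈ pts lines a ∧ x ≠ y ∧ x ≠ z ∧ y ≠ z := by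
  have hl := length_pts h ha
  have hnd := nodup_pts h ha
  have h0 : 0 < (pts lines a).length := by omega
  have h1 : 1 < (pts lines a).length := by omega
  have h2 : 2 < (pts lines a).length := by omega
  refine ⟨(pts lines a)[0], (pts lines a)[1], (pts lines a)[2], getElem_mem _, getElem_mem _, getElem_mem _, ?_, ?_, ?_⟩
  · intro e; have := hnd.getElem_inj_iff.mp e; omega
  · intro e; have := hnd.getElem_inj_iff.mp e; omega
  · intro e; have := hnd.getElem_inj_iff.mp e; omega

/-- two points on a line other than a given point (`2 ≤ n`) -/
theorem exists_two_mem_pts_ne (hn : 2 ≤ n) {a : ℕ} (ha : a < n * n + n + 1) (p : ℕ) :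
    ∃ x y, x ∈ pts lines a ∧ y ∈ pts lines a ∧ x ≠ y ∧ x ≠ p ∧ y ≠ p := by
  obtain ⟨x, y, z, hx, hy, hz, hxy, hxz, hyz⟩ := exists_three_mem_pts h hn ha
  by_cases hxp : x = p
  · exact ⟨y, z, hy, hz, hyz, fun e => hxy (hxp.trans e.symm), fun e => hxz (hxp.trans e.symm)⟩
  by_cases hyp : y = p
  · exact ⟨x, z, hx, hz, hxz, hxp, fun e => hyz (hyp.trans e.symm)⟩
  · exact ⟨x, y, hx, hy, hxy, hxp, hyp⟩

/-- two points on two common lines: the points or the lines coincide -/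
theorem eq_or_eq_cert {p₁ p₂ : CPt n lines} {l₁ l₂ : CLn n lines} (h₁ : p₁ ∈ l₁) (h₂ : p₂ ∈ l₁) (h₃ : p₁ ∈ l₂) (h₄ : p₂ ∈ l₂) :
    p₁ = p₂ ∨ l₁ = l₂ := by
  by_cases hp : p₁ = p₂
  · exact Or.inl hp
  · refine Or.inr (CLn.ext (Fin.ext ?_))
    have hpq : (p₁.idx : ℕ) ≠ p₂.idx := fun e => hp (CPt.ext (Fin.ext e))
    exact line_through_unique h p₁.idx.2 p₂.idx.2 hpq l₁.idx.2 l₂.idx.2 h₁ h₂ h₃ h₄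

end Axioms

/-! ### The projective plane -/

section Plane

variable (h : isProjectivePlane n lines = true) (hn : 2 ≤ n)
include h hn

/-- a line missing a given point: through a point `q` off a line `l₀ ∋ p` and a second point `r ∈ l₀` -/
theorem exists_line_not_mem (p : CPt n lines) : ∃ l : CLn n lines, p ∉ l := by
  let l₀ : CLn n lines := ⟨⟨0, by omega⟩⟩
  by_cases hp : p ∈ l₀
  · obtain ⟨q, hq, hql⟩ := exists_not_mem_pts h (by omega) l₀.idx.2
    obtain ⟨x, y, hx, hy, hxy, hxp, hyp⟩ := exists_two_mem_pts_ne h hn l₀.idx.2 p.idx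
    -- the line through `q` and `x`
    have hqx : q ≠ x := fun e => hql (e ▸ hx)
    obtain ⟨a, ha, hqa, hxa⟩ := exists_line_through h hq (lt_of_mem_pts h l₀.idx.2 hx) hqx
    refine ⟨⟨⟨a, ha⟩⟩, fun hpa => ?_⟩
    -- `p, x ∈ l₀ ∩ a` with `p ≠ x` forces `a = l₀`, putting `q` on `l₀`
    have := line_through_unique h p.idx.2 (lt_of_mem_pts h l₀.idx.2 hx) (Ne.symm hxp) ha l₀.idx.2 hpa hxa hp hx
    subst this
    exact hql hqa
  · exact ⟨l₀, hp⟩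

/-- **The certified structure is a projective plane** (Mathlib `Configuration.ProjectivePlane`). -/
@[reducible] noncomputable def certPlane : ProjectivePlane (CPt n lines) (CLn n lines) where
  exists_point := fun l => by
    obtain ⟨p, hp, hpl⟩ := exists_not_mem_pts h (by omega) l.idx.2
    exact ⟨⟨⟨p, hp⟩⟩, hpl⟩
  exists_line := exists_line_not_mem h hn
  eq_or_eq := eq_or_eq_cert h
  mkPoint := fun {l₁ l₂} hl =>
    ⟨⟨Classical.choose (exists_meet h l₁.idx.2 l₂.idx.2 fun e => hl (CLn.ext (Fin.ext e))),
      lt_of_mem_pts h l₁.idx.2 (Classical.choose_spec (exists_meet h l₁.idx.2 l₂.idx.2 fun e => hl (CLn.ext (Fin.ext e)))).1⟩⟩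
  mkPoint_ax := fun {l₁ l₂} hl =>
    Classical.choose_spec (exists_meet h l₁.idx.2 l₂.idx.2 fun e => hl (CLn.ext (Fin.ext e)))
  mkLine := fun {p₁ p₂} hp =>
    ⟨⟨Classical.choose (exists_line_through h p₁.idx.2 p₂.idx.2 fun e => hp (CPt.ext (Fin.ext e))),
      (Classical.choose_spec (exists_line_through h p₁.idx.2 p₂.idx.2 fun e => hp (CPt.ext (Fin.ext e)))).1⟩⟩
  mkLine_ax := fun {p₁ p₂} hp =>
    (Classical.choose_spec (exists_line_through h p₁.idx.2 p₂.idx.2 fun e => hp (CPt.ext (Fin.ext e)))).2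
  exists_config := by
    -- l₂ := line 0 with points p₂ ≠ p₃; r ∉ l₂; l₃ := line(p₂, r); m := line(p₃, r); p₁ ∈ m third point; t ∈ l₃ third point;
    -- l₁ := line(p₁, t)
    have h0 : 0 < n * n + n + 1 := by omega
    obtain ⟨r, hr, hrl⟩ := exists_not_mem_pts h (by omega) h0
    obtain ⟨p₂, p₃, hp₂, hp₃, h23, -, -⟩ := exists_two_mem_pts_ne h hn h0 r
    have hp₂v := lt_of_mem_pts h h0 hp₂
    have hp₃v := lt_of_mem_pts h h0 hp₃
    have h2r : p₂ ≠ r := fun e => hrl (e ▸ hp₂)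
    have h3r : p₃ ≠ r := fun e => hrl (e ▸ hp₃)
    -- l₃ through p₂, r
    obtain ⟨a₃, ha₃, h2a₃, hra₃⟩ := exists_line_through h hp₂v hr h2r
    -- m through p₃, r
    obtain ⟨am, ham, h3m, hrm⟩ := exists_line_through h hp₃v hr h3r
    -- a₃ ≠ line 0, m ≠ line 0 (they contain r), p₃ ∉ a₃
    have hp₃a₃ : p₃ ∉ pts lines a₃ := fun hh =>
      hrl (line_through_unique h hp₂v hp₃v h23 ha₃ h0 h2a₃ hh hp₂ hp₃ ▸ hra₃)
    -- p₁ : a point of m other than p₃ and r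
    obtain ⟨u, w, hu, hw, huw, hur, hwr⟩ := exists_two_mem_pts_ne h hn ham r
    -- among u, w (both ≠ r) at least one is ≠ p₃
    obtain ⟨p₁, hp₁m, h1r, h13⟩ : ∃ p₁, p₁ ∈ pts lines am ∧ p₁ ≠ r ∧ p₁ ≠ p₃ := by
      by_cases hu3 : u = p₃
      · exact ⟨w, hw, hwr, fun e => huw (hu3.trans e.symm)⟩
      · exact ⟨u, hu, hur, hu3⟩
    have hp₁v := lt_of_mem_pts h ham hp₁m
    -- p₁ ∉ line 0, p₁ ∉ a₃
    have hp₁0 : p₁ ∉ pts lines 0 := fun hh =>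
      hrl (line_through_unique h hp₁v hp₃v h13 ham h0 hp₁m h3m hh hp₃ ▸ hrm)
    have hp₁a₃ : p₁ ∉ pts lines a₃ := fun hh =>
      hp₃a₃ (line_through_unique h hp₁v hr h1r ham ha₃ hp₁m hrm hh hra₃ ▸ h3m)
    -- t : a point of a₃ other than p₂ and r
    obtain ⟨u', w', hu', hw', huw', hur', hwr'⟩ := exists_two_mem_pts_ne h hn ha₃ r
    obtain ⟨t, hta₃, htr, ht2⟩ : ∃ t, t ∈ pts lines a₃ ∧ t ≠ r ∧ t ≠ p₂ := by
      by_cases hu2 : u' = p₂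
      · exact ⟨w', hw', hwr', fun e => huw' (hu2.trans e.symm)⟩
      · exact ⟨u', hu', hur', hu2⟩
    have htv := lt_of_mem_pts h ha₃ hta₃
    have h1t : p₁ ≠ t := fun e => hp₁a₃ (e ▸ hta₃)
    -- l₁ through p₁, t
    obtain ⟨a₁, ha₁, h1a₁, hta₁⟩ := exists_line_through h hp₁v htv h1t
    -- p₂ ∉ l₁: else l₁ = a₃ (p₂, t) and p₁ ∈ a₃
    have hp₂a₁ : p₂ ∉ pts lines a₁ := fun hh =>
      hp₁a₃ (line_through_unique h hp₂v htv (Ne.symm ht2) ha₁ ha₃ hh hta₁ h2a₃ hta₃ ▸ h1a₁)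
    -- p₃ ∉ l₁: else l₁ = m (p₁, p₃), so t ∈ m; t, r ∈ m ∩ a₃ forces m = a₃ ∋ p₃
    have hp₃a₁ : p₃ ∉ pts lines a₁ := fun hh => by
      have e1 := line_through_unique h hp₁v hp₃v h13 ha₁ ham h1a₁ hh hp₁m h3m
      subst e1
      have e2 := line_through_unique h htv hr htr ha₁ ha₃ hta₁ hrm hta₃ hra₃
      subst e2
      exact hp₃a₃ h3m
    refine ⟨⟨⟨p₁, hp₁v⟩⟩, ⟨⟨p₂, hp₂v⟩⟩, ⟨⟨p₃, hp₃v⟩⟩, ⟨⟨a₁, ha₁⟩⟩, ⟨⟨0, h0⟩⟩, ⟨⟨a₃, ha₃⟩⟩,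
      hp₁0, hp₁a₃, hp₂a₁, hp₂, h2a₃, hp₃a₁, hp₃, hp₃a₃⟩

/-- **The certified plane has order `n`.** -/
theorem order_certPlane : @ProjectivePlane.order (CPt n lines) (CLn n lines) _ (certPlane h hn) = n := by
  letI := certPlane h hn
  have hc := ProjectivePlane.card_points (CPt n lines) (CLn n lines)
  rw [CPt.card] at hc
  set k := ProjectivePlane.order (CPt n lines) (CLn n lines)
  nlinarith [sq_nonneg (k - n), sq_nonneg (k + n)]

/-- **Soundness of `isProjectivePlane`:** a certified line list gives a finite projective plane of order `n`. -/
theorem existsPlane_of_certificate :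
    ∃ (P L : Type) (_ : Membership P L) (_ : Fintype P) (_ : Fintype L) (_ : ProjectivePlane P L),
      ProjectivePlane.order P L = n :=
  ⟨CPt n lines, CLn n lines, inferInstance, inferInstance, inferInstance, certPlane h hn, order_certPlane h hn⟩

end Plane

/-- **HIT protocol (M-b), plane form:** a list of 157 lines passing `isProjectivePlane 12` proves `ExistsProjectivePlaneOrder12`. -/
theorem existsPlaneOrder12_of_certificate {lines : List (List ℕ)} (h : isProjectivePlane 12 lines = true) :
    ExistsProjectivePlaneOrder12 :=
  existsPlane_of_certificate h (by norm_num)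

/-- control: the Fano certificate of `DesignsKernel` gives a projective plane of order 2 -/
theorem exists_plane_order_two_of_fano :
    ∃ (P L : Type) (_ : Membership P L) (_ : Fintype P) (_ : Fintype L) (_ : ProjectivePlane P L),
      ProjectivePlane.order P L = 2 :=
  existsPlane_of_certificate fano_ok (le_refl 2)

end Summit.Ventures.DiscreteObjects.PP12
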